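import Literature.Probability.Exchangeability.Exchangeable
import HarnessLib

/-!
# Exchangeability through finite-dimensional marginals

Kallenberg's definition of exchangeability is finite-dimensional:
`(ξ_{k₁}, …, ξ_{kₙ}) =ᵈ (ξ₁, …, ξₙ)` for all `n` and all permutations / distinct indices.  Here we
connect it with `IsExchangeable` (invariance of the law on `ℕ → E`):

* the `π`-system `initialCylinders E` of measurable preimages under the initial-segment
  projections `proj n` generates the product σ-algebra (`generateFrom_initialCylinders`);
* `measure_eq_of_forall_map_proj_eq` — a finite measure on `ℕ → E` is determined by its laws on
  the initial segments `Fin n → E`;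
* `isExchangeable_iff_map_proj_perm` — **`P` is exchangeable iff every initial-segment marginal
  `P ∘ (proj n)⁻¹` is invariant under the permutations of `Fin n`** (the criterion one checks
  for a law built by Kolmogorov extension from symmetric finite-dimensional laws).

All proved (Mathlib only).

## References

* O. Kallenberg, *Foundations of Modern Probability*, 2nd ed. (2002), Ch. 11, eq. (6) before
  Thm 11.10. [Kallenberg2002]
-/

namespace Literature.Probability.Exchangeability

open _root_.MeasureTheory Equiv Function Set

variable {E : Type*} [MeasurableSpace E]

/-- The initial cylinders form a `π`-system. [folklore] -/
theorem isPiSystem_initialCylinders : IsPiSystem (initialCylinders E) := by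
  rintro _ ⟨n₁, A₁, hA₁, rfl⟩ _ ⟨n₂, A₂, hA₂, rfl⟩ _
  refine ⟨max n₁ n₂, projLE (le_max_left n₁ n₂) ⁻¹' A₁ ∩ projLE (le_max_right n₁ n₂) ⁻¹' A₂,
    (measurable_projLE _ hA₁).inter (measurable_projLE _ hA₂), ?_⟩
  rw [Set.preimage_inter, ← Set.preimage_comp, ← Set.preimage_comp, projLE_comp_proj,
    projLE_comp_proj]

/-- The initial cylinders generate the product σ-algebra of `ℕ → E`. [folklore] -/
theorem generateFrom_initialCylinders :
    MeasurableSpace.generateFrom (initialCylinders E) =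
      (MeasurableSpace.pi : MeasurableSpace (ℕ → E)) := by
  apply le_antisymm
  · exact MeasurableSpace.generateFrom_le fun S hS => measurableSet_of_mem_initialCylinders hS
  · refine iSup_le fun i => ?_
    rw [MeasurableSpace.comap_le_iff_le_map]
    intro B hB
    refine MeasurableSpace.measurableSet_generateFrom ⟨i + 1,
      (fun y : Fin (i + 1) → E => y (Fin.last i)) ⁻¹' B, measurable_pi_apply _ hB, ?_⟩
    ext x
    simp [proj]

/-- **A finite measure on `ℕ → E` is determined by its initial-segment marginals.** [folklore] -/
theorem measure_eq_of_forall_map_proj_eq {P Q : Measure (ℕ → E)} [IsFiniteMeasure P]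
    (hPQ : ∀ n, P.map (proj n) = Q.map (proj n)) : P = Q := by
  have huniv : P Set.univ = Q Set.univ := by
    have h0 := congrArg (fun μ : Measure (Fin 0 → E) => μ Set.univ) (hPQ 0)
    simpa only [Measure.map_apply (measurable_proj 0) MeasurableSet.univ, Set.preimage_univ]
      using h0
  refine ext_of_generate_finite _ generateFrom_initialCylinders.symm isPiSystem_initialCylinders
    ?_ huniv
  rintro _ ⟨n, A, hA, rfl⟩
  rw [← Measure.map_apply (measurable_proj n) hA, ← Measure.map_apply (measurable_proj n) hA, hPQ n]

/-- Transpositions of `ℕ` below `N` and of `Fin N` agree on values. [folklore] -/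
theorem val_swap_fin {N a b : ℕ} (ha : a < N) (hb : b < N) (i : Fin N) :
    ((swap (⟨a, ha⟩ : Fin N) ⟨b, hb⟩ i : Fin N) : ℕ) = swap a b (i : ℕ) := by
  rw [swap_apply_def, swap_apply_def]
  simp only [Fin.ext_iff]
  split_ifs <;> rfl

/-- **Exchangeability is a property of the finite-dimensional marginals**: `P` (finite) is
exchangeable iff for every `n` and every permutation `τ` of `Fin n` the law of
`(x (τ 0), …, x (τ (n-1)))` equals the law of `(x 0, …, x (n-1))`.
[cite: Kallenberg2002, Ch. 11, eq. (6)] -/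
theorem isExchangeable_iff_map_proj_perm {P : Measure (ℕ → E)} [IsFiniteMeasure P] :
    IsExchangeable P ↔ ∀ (n : ℕ) (τ : Perm (Fin n)),
      P.map (fun (x : ℕ → E) (i : Fin n) => x (τ i)) = P.map (proj n) := by
  constructor
  · intro h n τ
    exact h.map_sample_eq (fun i => ((τ i : Fin n) : ℕ)) (Fin.val_injective.comp τ.injective)
  · intro hsym
    refine IsExchangeable.of_swap fun a b => ?_
    refine measure_eq_of_forall_map_proj_eq fun n => ?_
    obtain ⟨N, hnN, haN, hbN⟩ : ∃ N, n ≤ N ∧ a < N ∧ b < N :=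
      ⟨max n (max a b + 1), le_max_left _ _, by omega, by omega⟩
    rw [← projLE_comp_proj hnN, ← Measure.map_map (measurable_projLE hnN) (measurable_proj N),
      ← Measure.map_map (measurable_projLE hnN) (measurable_proj N),
      Measure.map_map (measurable_proj N) (measurable_comp_right _)]
    congr 1
    set τ : Perm (Fin N) := swap ⟨a, haN⟩ ⟨b, hbN⟩ with hτ
    have hcomp : proj N ∘ (fun x : ℕ → E => x ∘ swap a b) = fun x (i : Fin N) => x (τ i) := by
      funext x; ext i
      simp only [comp_apply, proj, hτ, val_swap_fin haN hbN i]
    rw [hcomp, hsym N τ]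

/-- In particular, an exchangeable law has permutation-invariant initial-segment marginals:
`(P ∘ (proj n)⁻¹) ∘ (· ∘ τ)⁻¹ = P ∘ (proj n)⁻¹`. [cite: Kallenberg2002, Ch. 11, eq. (6)] -/
theorem IsExchangeable.map_proj_map_perm {P : Measure (ℕ → E)} (h : IsExchangeable P) (n : ℕ)
    (τ : Perm (Fin n)) :
    (P.map (proj n)).map (fun y : Fin n → E => y ∘ τ) = P.map (proj n) := by
  have hm : Measurable (fun y : Fin n → E => y ∘ τ) :=
    measurable_pi_lambda _ fun i => measurable_pi_apply _
  rw [Measure.map_map hm (measurable_proj n)]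
  exact h.map_sample_eq (fun i => ((τ i : Fin n) : ℕ)) (Fin.val_injective.comp τ.injective)

end Literature.Probability.Exchangeability
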